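/-
Copyright (c) 2026. All rights reserved.
Released under Apache 2.0 license as described in the file LICENSE.
Authors: abc-iut cell, wave-2 seat abc-iut-L3-t11 (proof-only; tree-side input of [SemiAnbd]
Thm 3.7 (iii) second part / (iv), G10 rung 3b).
-/
import Mathlib.Data.Set.Card
import Literature.AnabelianGeometry.SemiGraphs.FreeGroupsAndActionsProofs3
import HarnessLib

/-!
# Two fixed vertices of a tree: the fixed-pair dichotomy ([SemiAnbd] Lemma 1.8 (ii)(b)(c), packaged for Theorem 3.7 (iii))

Mochizuki, *Semi-graphs of anabelioids*, Publ. RIMS **42** (2006) [MochizukiSemiAnbd2006], Lemma 1.8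
(ii)(b)(c) p. 20 and the proof of Theorem 3.7 (iii), second part, p. 41: a nontrivial compact subgroup
lying in two distinct verticial subgroups fixes two distinct vertices of (each finite level of) the
universal graph-covering tree; by Lemma 1.8 (ii)(b) it fixes the geodesic between them; total estrangement
forbids a nontrivial group fixing a subjoint, so the geodesic is a single CLOSED edge whose edge group
contains the compact subgroup, and no third vertex is fixed.

This PROOF-ONLY file supplies the purely combinatorial (tree-side) half of that argument, over the
landed Lemma 1.8 (ii)(b)(c) files (`FreeGroupsAndActionsProofs2/3`, `SubdivisionPaths`):

* `fixed_pair_dichotomy` — a group `Γ` acting on a tree `G` and fixing two distinct vertices `w₁ ≠ w₂`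
  EITHER acts trivially on some subjoint of `G`, OR `w₁`, `w₂` are joined by a single edge `e` (distinct
  branches `c`, `c'` at `w₁`, `w₂`), which `Γ` fixes together with both its branches;
* `isClosedEdge_of_abuts` — such an `e` is a closed edge;
* `fixed_pair_adjacent_of_no_subjoint`, `fixed_third_vertex_of_no_subjoint` — under "`Γ` acts
  trivially on NO subjoint" (the shadow of total estrangement): two distinct fixed vertices are joined by a
  fixed closed edge, and there is no third fixed vertex.

No definitions; nothing here is specific to anabelioids.
-/

namespace Literature.AnabelianGeometry.SemiGraphs

namespace SemiGraph

open CategoryTheory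

universe u

variable {G : SemiGraph.{u}}

/-! ### Closed edges from two abutting branches -/

/-- An edge with two distinct abutting branches is closed (its verticial cardinality is `2`).
[cite: MochizukiSemiAnbd2006, §1 p.12] -/
theorem isClosedEdge_of_abuts {e : G.Edge} {c c' : G.Branch} (hcc : c ≠ c') (hce : G.edgeOf c = e)
    (hc'e : G.edgeOf c' = e) {w₁ w₂ : G.Vertex} (hcw : G.abuts c = some w₁) (hc'w : G.abuts c' = some w₂) :
    G.IsClosedEdge e := by
  have hset : G.verticialPortion e = {c, c'} := by
    ext b
    simp only [verticialPortion, Set.mem_setOf_eq, Set.mem_insert_iff, Set.mem_singleton_iff]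
    constructor
    · rintro ⟨hbe, -⟩
      by_cases hbc : b = c
      · exact Or.inl hbc
      · exact Or.inr (branch_eq_of_ne_of_ne hce hbe hc'e hbc (Ne.symm hcc))
    · rintro (rfl | rfl)
      · exact ⟨hce, by rw [hcw]; rfl⟩
      · exact ⟨hc'e, by rw [hc'w]; rfl⟩
  unfold IsClosedEdge vertCard
  rw [hset, Nat.card_coe_set_eq, Set.ncard_pair hcc]

/-! ### Branches of a fixed edge at a fixed vertex -/

/-- In a tree, an automorphism fixing a vertex `v` and an edge `e` with a branch at `v` fixes every branch
of `e` (the branch at `v` by uniqueness of branches at a vertex in a tree, the other one because `e` has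
exactly two branches). [cite: MochizukiSemiAnbd2006, Lem. 1.8(ii)(b) p.20] -/
theorem branchMap_eq_self_of_fixed (hA : G.subdivision.IsAcyclic) (σ : Aut G) {v : G.Vertex}
    {e : G.Edge} {c : G.Branch} (hce : G.edgeOf c = e) (hcv : G.abuts c = some v)
    (hv : σ.hom.vertexMap v = v) (he : σ.hom.edgeMap e = e) (b : G.Branch) (hbe : G.edgeOf b = e) :
    σ.hom.branchMap b = b := by
  have hσc : σ.hom.branchMap c = c := by
    refine branch_unique_of_isAcyclic hA ?_ (by rw [σ.hom.abuts_branchMap c v hcv, hv]) hcv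
    rw [σ.hom.edgeOf_branchMap, hce, he]
  by_cases hbc : b = c
  · rw [hbc, hσc]
  · have h1 : G.edgeOf (σ.hom.branchMap b) = e := by rw [σ.hom.edgeOf_branchMap, hbe, he]
    have h2 : σ.hom.branchMap b ≠ c := by
      intro h
      rw [← hσc] at h
      exact hbc (σ.hom.branchMap_injOn b c (by rw [hbe, hce]) h)
    exact branch_eq_of_ne_of_ne hce h1 hbe h2 hbc

/-! ### The fixed-pair dichotomy -/

/-- **Fixed-pair dichotomy** (Lemma 1.8 (ii)(b) + the case analysis of (ii)(c)): let a group `Γ` act on a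
tree `G` fixing two distinct vertices `w₁ ≠ w₂`. Then EITHER `Γ` acts trivially on some subjoint of `G`
(an interior vertex of the geodesic `w₁ — w₂` with its two geodesic edges), OR `w₁` and `w₂` are joined by a
single edge `e` — branches `c ≠ c'` abutting to `w₁`, `w₂` — and `Γ` fixes `e` and all its branches.
[cite: MochizukiSemiAnbd2006, Lem. 1.8(ii)(b)(c) p.20] -/
theorem fixed_pair_dichotomy {Γ : Type u} [Group Γ] (ρ : Γ →* Aut G) (hG : G.IsTree)
    {w₁ w₂ : G.Vertex} (hne : w₁ ≠ w₂) (hw₁ : ∀ γ, (ρ γ).hom.vertexMap w₁ = w₁)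
    (hw₂ : ∀ γ, (ρ γ).hom.vertexMap w₂ = w₂) :
    (∃ H : G.Subgraph, H.IsSubjoint ∧ H.IsFixedPointwise ρ) ∨
    (∃ (e : G.Edge) (c c' : G.Branch), c ≠ c' ∧ G.edgeOf c = e ∧ G.edgeOf c' = e ∧
      G.abuts c = some w₁ ∧ G.abuts c' = some w₂ ∧
      ∀ γ, (ρ γ).hom.edgeMap e = e ∧ ∀ b : G.Branch, G.edgeOf b = e → (ρ γ).hom.branchMap b = b) := by
  have hA : G.subdivision.IsAcyclic := hG.isTree.isAcyclic
  have hC : G.subdivision.Connected := hG.isTree.connected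
  -- fixed nodes along the geodesic, by (ii)(b)
  obtain ⟨p, hp⟩ := hC.exists_isPath (Sum.inl w₁) (Sum.inl w₂)
  have fixV : ∀ z ∈ p.support, ∀ γ, nodeMap (ρ γ) z = z := fun z hz γ =>
    nodeMap_eq_self_of_isPath hA (ρ γ) (by simp [hw₁ γ]) (by simp [hw₂ γ]) p hp z hz
  rcases path_between_vertices_shape hne p hp with
    ⟨v, e₁, e₂, c₁, c₂, hee, hc₁e, hc₁v, hc₂e, hc₂v, hvs, he₁s, he₂s⟩ | ⟨e, c, c', hcc, hce, hc'e, hcw₁, hc'w₂, hes⟩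
  · left
    refine ⟨⟨{v}, {e₁, e₂}⟩, isSubjoint_pair hA hee hc₁e hc₁v hc₂e hc₂v,
      isFixedPointwise_pair hA ρ hc₁e hc₁v hc₂e hc₂v ?_ ?_ ?_⟩
    · intro γ; simpa using fixV _ hvs γ
    · intro γ; simpa using fixV _ he₁s γ
    · intro γ; simpa using fixV _ he₂s γ
  · right
    have hefix : ∀ γ, (ρ γ).hom.edgeMap e = e := fun γ => by simpa using fixV _ hes γ
    exact ⟨e, c, c', hcc, hce, hc'e, hcw₁, hc'w₂, fun γ =>
      ⟨hefix γ, fun b hbe => branchMap_eq_self_of_fixed hA (ρ γ) hce hcw₁ (hw₁ γ) (hefix γ) b hbe⟩⟩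

/-! ### Under "no fixed subjoint" (the shadow of total estrangement) -/

/-- If `Γ` fixes two distinct vertices of a tree and acts trivially on NO subjoint, the two vertices are
joined by a single CLOSED edge, fixed by `Γ` together with its branches.
[cite: MochizukiSemiAnbd2006, Thm 3.7(iii) p.41] -/
theorem fixed_pair_adjacent_of_no_subjoint {Γ : Type u} [Group Γ] (ρ : Γ →* Aut G) (hG : G.IsTree)
    (hno : ¬ ∃ H : G.Subgraph, H.IsSubjoint ∧ H.IsFixedPointwise ρ)
    {w₁ w₂ : G.Vertex} (hne : w₁ ≠ w₂) (hw₁ : ∀ γ, (ρ γ).hom.vertexMap w₁ = w₁)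
    (hw₂ : ∀ γ, (ρ γ).hom.vertexMap w₂ = w₂) :
    ∃ (e : G.Edge) (c c' : G.Branch), G.IsClosedEdge e ∧ c ≠ c' ∧ G.edgeOf c = e ∧ G.edgeOf c' = e ∧
      G.abuts c = some w₁ ∧ G.abuts c' = some w₂ ∧
      ∀ γ, (ρ γ).hom.edgeMap e = e ∧ ∀ b : G.Branch, G.edgeOf b = e → (ρ γ).hom.branchMap b = b := by
  rcases fixed_pair_dichotomy ρ hG hne hw₁ hw₂ with h | ⟨e, c, c', hcc, hce, hc'e, hcw₁, hc'w₂, hfix⟩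
  · exact absurd h hno
  · exact ⟨e, c, c', isClosedEdge_of_abuts hcc hce hc'e hcw₁ hc'w₂, hcc, hce, hc'e, hcw₁, hc'w₂, hfix⟩

/-- If a finite group `Γ` fixes two distinct vertices `w₁ ≠ w₂` of a tree and acts trivially on NO subjoint,
then it fixes no third vertex (Lemma 1.8 (ii)(c)). [cite: MochizukiSemiAnbd2006, Thm 3.7(iii) p.41] -/
theorem fixed_third_vertex_of_no_subjoint {Γ : Type u} [Group Γ] [Finite Γ] (ρ : Γ →* Aut G)
    (hG : G.IsTree) (hno : ¬ ∃ H : G.Subgraph, H.IsSubjoint ∧ H.IsFixedPointwise ρ)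
    {w₁ w₂ : G.Vertex} (hne : w₁ ≠ w₂) (hw₁ : ∀ γ, (ρ γ).hom.vertexMap w₁ = w₁)
    (hw₂ : ∀ γ, (ρ γ).hom.vertexMap w₂ = w₂) {w₃ : G.Vertex} (hw₃ : ∀ γ, (ρ γ).hom.vertexMap w₃ = w₃) :
    w₃ = w₁ ∨ w₃ = w₂ := by
  by_contra h
  push Not at h
  exact hno (lemma_1_8_ii_c_holds G Γ ρ hG w₁ w₂ w₃ hne (Ne.symm h.2) (Ne.symm h.1) hw₁ hw₂ hw₃)

/-- The set of vertices fixed by `Γ` has at most two elements when `Γ` (finite) acts on a tree trivially on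
no subjoint. [cite: MochizukiSemiAnbd2006, Thm 3.7(iii) p.41] -/
theorem ncard_fixed_vertices_le_two {Γ : Type u} [Group Γ] [Finite Γ] (ρ : Γ →* Aut G)
    (hG : G.IsTree) (hno : ¬ ∃ H : G.Subgraph, H.IsSubjoint ∧ H.IsFixedPointwise ρ) :
    {w : G.Vertex | ∀ γ, (ρ γ).hom.vertexMap w = w}.ncard ≤ 2 := by
  classical
  by_contra hlt
  push Not at hlt
  have hfin := Set.finite_of_ncard_pos (lt_trans (by norm_num) hlt)
  obtain ⟨w₁, w₂, w₃, hw₁, hw₂, hw₃, h₁₂, h₁₃, h₂₃⟩ := (Set.two_lt_ncard_iff hfin).mp hlt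
  rcases fixed_third_vertex_of_no_subjoint ρ hG hno h₁₂ hw₁ hw₂ hw₃ with h | h
  · exact h₁₃ h.symm
  · exact h₂₃ h.symm

/-! ### The form used in the proof of Theorem 3.7 (iii) (appended): a third fixed vertex, or adjacency -/

/-- **Two fixed vertices: a THIRD fixed vertex between them, or a single closed edge** — the form in
which Lemma 1.8 (ii)(b) enters the proof of [SemiAnbd] Thm 3.7 (iii) (p. 41: "if `H` fixes two vertices
of `G_{∞,j}`, then [as `H` does not fix `≥ 3` vertices] these two vertices are joined to one another by a
single [closed] edge"): if a group fixes `w₁ ≠ w₂` in a tree, then EITHER some vertex `v ∉ {w₁, w₂}` (an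
interior vertex of the geodesic) is fixed as well, OR `w₁`, `w₂` are joined by a single edge `e` (distinct
branches `c`, `c'` at `w₁`, `w₂`; `e` closed) fixed together with all its branches.
[cite: MochizukiSemiAnbd2006, Thm 3.7(iii) p.41] -/
theorem fixed_pair_third_or_adjacent {Γ : Type u} [Group Γ] (ρ : Γ →* Aut G) (hG : G.IsTree)
    {w₁ w₂ : G.Vertex} (hne : w₁ ≠ w₂) (hw₁ : ∀ γ, (ρ γ).hom.vertexMap w₁ = w₁)
    (hw₂ : ∀ γ, (ρ γ).hom.vertexMap w₂ = w₂) :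
    (∃ v : G.Vertex, v ≠ w₁ ∧ v ≠ w₂ ∧ ∀ γ, (ρ γ).hom.vertexMap v = v) ∨
    (∃ (e : G.Edge) (c c' : G.Branch), G.IsClosedEdge e ∧ c ≠ c' ∧ G.edgeOf c = e ∧ G.edgeOf c' = e ∧
      G.abuts c = some w₁ ∧ G.abuts c' = some w₂ ∧
      ∀ γ, (ρ γ).hom.edgeMap e = e ∧ ∀ b : G.Branch, G.edgeOf b = e → (ρ γ).hom.branchMap b = b) := by
  have hA : G.subdivision.IsAcyclic := hG.isTree.isAcyclic
  have hC : G.subdivision.Connected := hG.isTree.connected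
  obtain ⟨p, hp⟩ := hC.exists_isPath (Sum.inl w₁) (Sum.inl w₂)
  have fixV : ∀ z ∈ p.support, ∀ γ, nodeMap (ρ γ) z = z := fun z hz γ =>
    nodeMap_eq_self_of_isPath hA (ρ γ) (by simp [hw₁ γ]) (by simp [hw₂ γ]) p hp z hz
  set n := p.length with hn
  have hx0 : p.getVert 0 = Sum.inl w₁ := p.getVert_zero
  have hxn : p.getVert n = Sum.inl w₂ := p.getVert_length
  -- `w₁ – c₁ – e₁ – c₁' – v₁`
  have h0n : 0 < n := lt_length_of_getVert_ne p (Nat.zero_le _) (by rw [hx0]; simpa using hne)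
  obtain ⟨c₁, hc₁v, hx1⟩ := step_vertex p h0n hx0
  have h1n : 1 < n := lt_length_of_getVert_ne p h0n (by rw [hx1]; simp)
  have hx2 : p.getVert 2 = Sum.inr (Sum.inl (G.edgeOf c₁)) := by
    rcases step_branch p h1n hx1 with h | ⟨v, hv, h⟩
    · exact h
    · exfalso
      have hvw : v = w₁ := by rw [hc₁v] at hv; simpa using hv.symm
      exact getVert_add_two_ne p hp (i := 0) (by omega) (by rw [h, hx0, hvw])
  have h2n : 2 < n := lt_length_of_getVert_ne p h1n (by rw [hx2]; simp)
  obtain ⟨c₁', hc₁'e, hx3⟩ := step_edge p h2n hx2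
  have hcc : c₁' ≠ c₁ := by
    intro h
    exact getVert_add_two_ne p hp (i := 1) (by omega) (by rw [hx3, hx1, h])
  have h3n : 3 < n := lt_length_of_getVert_ne p h2n (by rw [hx3]; simp)
  obtain ⟨v₁, hc₁'v, hx4⟩ : ∃ v₁ : G.Vertex, G.abuts c₁' = some v₁ ∧ p.getVert 4 = Sum.inl v₁ := by
    rcases step_branch p h3n hx3 with h | h
    · exfalso
      exact getVert_add_two_ne p hp (i := 2) (by omega) (by rw [h, hx2, hc₁'e])
    · exact h
  rcases Nat.lt_or_ge 4 n with h4n | h4n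
  · -- `v₁` is an interior vertex of the geodesic: a third fixed vertex
    left
    have hvs : Sum.inl v₁ ∈ p.support := by rw [← hx4]; exact p.getVert_mem_support 4
    refine ⟨v₁, ?_, ?_, fun γ => by simpa using fixV _ hvs γ⟩
    · intro h
      have h04 : p.getVert 4 = p.getVert 0 := by rw [hx4, hx0, h]
      have := hp.getVert_injOn (by simp only [Set.mem_setOf_eq]; omega)
        (by simp only [Set.mem_setOf_eq]; omega) h04
      omega
    · intro h
      have h4n' : p.getVert 4 = p.getVert n := by rw [hx4, hxn, h]
      have := hp.getVert_injOn (by simp only [Set.mem_setOf_eq]; omega)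
        (by simp only [Set.mem_setOf_eq]; omega) h4n'
      omega
  · -- `n = 4`: the single edge `e₁ = edgeOf c₁` joins `w₁` and `w₂`
    right
    have hn4 : n = 4 := le_antisymm h4n (by omega)
    have hvw : v₁ = w₂ := by
      have : p.getVert 4 = Sum.inl w₂ := by rw [← hn4]; exact hxn
      rw [hx4] at this
      simpa using this
    have hes : Sum.inr (Sum.inl (G.edgeOf c₁)) ∈ p.support := by rw [← hx2]; exact p.getVert_mem_support 2
    have hefix : ∀ γ, (ρ γ).hom.edgeMap (G.edgeOf c₁) = G.edgeOf c₁ := fun γ => by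
      simpa using fixV _ hes γ
    refine ⟨G.edgeOf c₁, c₁, c₁', isClosedEdge_of_abuts (Ne.symm hcc) rfl hc₁'e hc₁v (hvw ▸ hc₁'v),
      Ne.symm hcc, rfl, hc₁'e, hc₁v, hvw ▸ hc₁'v, fun γ => ⟨hefix γ, fun b hbe => ?_⟩⟩
    exact branchMap_eq_self_of_fixed hA (ρ γ) rfl hc₁v (hw₁ γ) (hefix γ) b hbe

/-- **Corollary (the shape used on p. 41)**: if the vertices fixed by `Γ` are among `{w₁, w₂}` (no third
fixed vertex) and `w₁ ≠ w₂` are fixed, then they are joined by a single closed edge fixed with its branches.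
[cite: MochizukiSemiAnbd2006, Thm 3.7(iii) p.41] -/
theorem fixed_pair_adjacent_of_no_third {Γ : Type u} [Group Γ] (ρ : Γ →* Aut G) (hG : G.IsTree)
    {w₁ w₂ : G.Vertex} (hne : w₁ ≠ w₂) (hw₁ : ∀ γ, (ρ γ).hom.vertexMap w₁ = w₁)
    (hw₂ : ∀ γ, (ρ γ).hom.vertexMap w₂ = w₂)
    (hno3 : ∀ v : G.Vertex, (∀ γ, (ρ γ).hom.vertexMap v = v) → v = w₁ ∨ v = w₂) :
    ∃ (e : G.Edge) (c c' : G.Branch), G.IsClosedEdge e ∧ c ≠ c' ∧ G.edgeOf c = e ∧ G.edgeOf c' = e ∧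
      G.abuts c = some w₁ ∧ G.abuts c' = some w₂ ∧
      ∀ γ, (ρ γ).hom.edgeMap e = e ∧ ∀ b : G.Branch, G.edgeOf b = e → (ρ γ).hom.branchMap b = b := by
  rcases fixed_pair_third_or_adjacent ρ hG hne hw₁ hw₂ with ⟨v, hv₁, hv₂, hv⟩ | h
  · rcases hno3 v hv with rfl | rfl
    · exact absurd rfl hv₁
    · exact absurd rfl hv₂
  · exact h

/-- **Three fixed vertices give a fixed subjoint also in the IMAGE under any equivariant morphism over
which the action descends** is how p. 41 passes from `G_{∞,j}` to the finite `G_j`; the tree-side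
input is just Lemma 1.8 (ii)(c) in the form: `≥ 3` fixed vertices ⇒ a fixed subjoint (re-export without
the cardinality bookkeeping). [cite: MochizukiSemiAnbd2006, Thm 3.7(iii) p.41] -/
theorem exists_fixed_subjoint_of_three {Γ : Type u} [Group Γ] [Finite Γ] (ρ : Γ →* Aut G)
    (hG : G.IsTree) {w₁ w₂ w₃ : G.Vertex} (h₁₂ : w₁ ≠ w₂) (h₂₃ : w₂ ≠ w₃) (h₁₃ : w₁ ≠ w₃)
    (hw₁ : ∀ γ, (ρ γ).hom.vertexMap w₁ = w₁) (hw₂ : ∀ γ, (ρ γ).hom.vertexMap w₂ = w₂)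
    (hw₃ : ∀ γ, (ρ γ).hom.vertexMap w₃ = w₃) :
    ∃ H : G.Subgraph, H.IsSubjoint ∧ H.IsFixedPointwise ρ :=
  lemma_1_8_ii_c_holds G Γ ρ hG w₁ w₂ w₃ h₁₂ h₂₃ h₁₃ hw₁ hw₂ hw₃

end SemiGraph

end Literature.AnabelianGeometry.SemiGraphs
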